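import Summits.Langlands.Langlands.Theorems.QuarterDeficit1951IcosahedralSupplyAway

/-!
# Route `QuarterDeficit1951` (Langlands) — crux `IcosahedralSupply` (stmt-Langlands-15899), line `Sketch`

**The crux reduced to one statement of `p`-adic Hodge theory about the pinned datum.**

Everything arithmetic in the crux `IcosahedralSupply` is proved in the tree
(`IcosahedralSupply_away`: the crux verbatim for every prime `ℓ ≥ 17`, `ℓ ≠ 1951`;
`artinSupply`: the even icosahedral Doud–Moore representation of conductor `1951` over any
algebraically closed field of characteristic `0`).  What is left is the instance `ℓ = 1951` of the
geometric conjunct `IsGeometricFramed RD ρ`, i.e. de Rham-ness at the place `v = (1951)` of a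
representation that is RAMIFIED there (conductor `1951`), relative to the PINNED `p`-adic Hodge
datum `RD.pst 1951 v hv = fontainePstAdicCompletion v 1951 hv = Classical.epsilon (IsFontaineDatum _)`
(`Literature/NumberTheory/PAdicHodge/FontaineDpst.lean`).

This file records the reduction in the tree:

* `IcosahedralSupply_of_finiteImage_isDeRhamFramed_1951` — the crux follows from the single
  statement "for the pinned datum of `ℚ` at the place above `1951`, every finite-image local
  representation `Γ_{ℚ_1951} → GL_n(ℚ̄_1951)` is de Rham".  For Fontaine's genuine `B_dR` this is a
  theorem (finite image ⇒ potentially unramified ⇒ potentially crystalline ⇒ de Rham: Fontaine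
  1994, Exp. III §1.5, §3, §5; Fontaine–Mazur 1995 §1), but it is NOT derivable for the `ε`-pinned
  datum from the structure axioms of `PstWeilDeligneData` (which give de Rham-ness of UNRAMIFIED
  representations only, and are met by the truncated model `F̂_nr`, for which de Rham = unramified:
  `Theorems/IcosahedralSupply/Negative/FalseWithoutPin.lean`) nor from the clauses (F1)–(F8) of
  `IsFontaineDatum` (none concerns ramified finite-image representations).  It becomes provable
  when the definition item `defn-FontainePstWeilDeligneData` (construction of `B_dR(K_v)` and
  `WD ∘ D_pst`, upgrading the body of `fontainePst` in place) lands, or — conditionally on the T0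
  named fact `FontaineDatumExists` — when the specification `IsFontaineDatum` gains the clause
  "finite-image (potentially unramified) representations are de Rham" (see the next item).
* `IcosahedralSupply_of_fontaineDatumExists_of_finiteImageClause` — the conditional form: under
  `FontaineDatumExists`, the crux follows from the clause "every datum with Fontaine's clauses makes
  finite-image representations de Rham" (the Upgrade-path clause addition (F9) of the `FontaineDpst`
  module docstring, stated here as a hypothesis; today it is not a consequence of (F1)–(F8)).

The cheap route-level alternative is unchanged: the route's deciding theorem `closes` uses the crux
only at `ℓ = 17`, and the restated crux `17 ≤ ℓ → ℓ ≠ 1951 → …` IS `IcosahedralSupply_away`.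
-/

set_option linter.dupNamespace false

noncomputable section

open scoped NumberField MatrixGroups
open Field IsDedekindDomain Polynomial
open Literature.NumberTheory.GaloisRepresentations Literature.NumberTheory.PAdicHodge

namespace Summit.Langlands.Langlands.Theorems.QuarterDeficit1951

/-- The local representation at a finite place of a finite-image representation has finite image
(its image is contained in the global one). [folklore] -/
theorem finite_range_toLocal {A : Type*} [CommRing A] [TopologicalSpace A] {n : ℕ}
    (ρ : FramedGaloisRep ℚ A n) (hfin : (Set.range ρ).Finite) (v : HeightOneSpectrum (𝓞 ℚ)) :
    (Set.range (ρ.toLocal v)).Finite :=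
  hfin.subset (by
    rintro _ ⟨σ, rfl⟩
    exact ⟨_, (FramedGaloisRep.toLocal_apply v ρ σ).symm⟩)

/-- **The crux reduced to one `p`-adic Hodge statement about the pinned datum.**  If, for the pinned
datum `fontainePstAdicCompletion v 1951 hv` of `ℚ` at the place `v` above `1951`, every finite-image
local representation `Γ_{ℚ_v} → GL_n(ℚ̄_1951)` is de Rham (a theorem for Fontaine's `B_dR`:
finite image ⇒ potentially unramified ⇒ de Rham; not derivable for the `ε`-pinned datum from the
present specification), then `IcosahedralSupply` holds: at `ℓ ≠ 1951` this is `IcosahedralSupply_away`,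
and at `ℓ = 1951` the Doud–Moore witness `artinSupply` over `ℚ̄_1951` is unramified away from `1951`
and of finite image, so the hypothesis supplies the geometric conjunct at `v = (1951)`.
[cite: FontaineAsterisque223III, Exp. III §1.5 and §3] [cite: FontaineMazurGeometric1995, §1]
[cite: DoudMoore2006, §2 and §4] -/
theorem IcosahedralSupply_of_finiteImage_isDeRhamFramed_1951
    (H : ∀ [Fact (Nat.Prime 1951)] (v : HeightOneSpectrum (𝓞 ℚ))
      (hv : ((1951 : ℕ) : 𝓞 ℚ) ∈ v.asIdeal) {n : ℕ}
      (r : FramedGaloisRep (v.adicCompletion ℚ) (PadicAlgCl 1951) n),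
      (Set.range r).Finite → (fontainePstAdicCompletion v 1951 hv).IsDeRhamFramed r) :
    Summit.Langlands.Langlands.Theses.QuarterDeficit1951.IcosahedralSupply := by
  intro RD ℓ _ h17
  by_cases hℓ : ℓ = 1951
  · subst hℓ
    obtain ⟨ι⟩ := PadicAlgCl.nonempty_ringEquiv_complex 1951
    obtain ⟨ρ, hirr, hfin, heven, hcond, χ₀, hχ₀, hv⟩ :=
      artinSupply (PadicAlgCl 1951) (ι : PadicAlgCl 1951 →+* ℂ)
    have hunr : ∀ v : HeightOneSpectrum (𝓞 ℚ), v.residueCard ≠ 1951 → ρ.IsUnramifiedAt v :=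
      fun v hv' => (hv v hv').1
    exact ⟨ι, ρ, ⟨eventually_isUnramifiedAt_of_away hunr,
      fun v hv' => H v hv' (ρ.toLocal v) (finite_range_toLocal ρ hfin v)⟩,
      hirr, hfin, heven, hcond, χ₀, hχ₀, hv⟩
  · exact IcosahedralSupply_away RD ℓ h17 hℓ

/-- **Conditional form (the Upgrade-path clause).**  Under Fontaine's existence theorem
`FontaineDatumExists` (T0 named fact of the summit), the crux follows from the clause "every
`p`-adic Hodge datum with Fontaine's characterising clauses `IsFontaineDatum` makes finite-image
representations de Rham" — the clause (F9) "potentially unramified ⇒ de Rham" of the `FontaineDpst`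
Upgrade path, a theorem for the genuine `(B_dR, WD ∘ D_pst)` (Fontaine 1994, Exp. III §1.5, §3, §5)
which is NOT a consequence of the present clauses (F1)–(F8); it enters here as a hypothesis only.
[cite: FontaineAsterisque223III, Exp. III §1.5 and §3] [cite: FontaineMazurGeometric1995, §1] -/
theorem IcosahedralSupply_of_fontaineDatumExists_of_finiteImageClause
    (hE : FontaineDatumExists)
    (hF9 : ∀ (F : Type) [Field F] [ValuativeRel F] [TopologicalSpace F]
      [IsNonarchimedeanLocalField F] [CharZero F] (ℓ : ℕ) [Fact ℓ.Prime]
      (hℓ : ValuativeRel.valuation F ℓ < 1) (𝔇 : PstWeilDeligneData F ℓ),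
      IsFontaineDatum hℓ 𝔇 → ∀ {n : ℕ} (r : FramedRep (absoluteGaloisGroup F) (PadicAlgCl ℓ) n),
        (Set.range r).Finite → 𝔇.IsDeRhamFramed r) :
    Summit.Langlands.Langlands.Theses.QuarterDeficit1951.IcosahedralSupply :=
  IcosahedralSupply_of_finiteImage_isDeRhamFramed_1951 fun v hv _ r hr => by
    haveI := LocalField.charZero_adicCompletion v
    exact hF9 (v.adicCompletion ℚ) 1951 _ _
      (isFontaineDatum_fontainePstAdicCompletion hE v 1951 hv) r hr

end Summit.Langlands.Langlands.Theorems.QuarterDeficit1951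

end
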